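import Summits.CriticalPhenomena.SAWScalingLimit.Theses.SAWRenewalTightness
import Summits.CriticalPhenomena.SAWScalingLimit.Theses.SAWParafermion
import Summits.CriticalPhenomena.SAWScalingLimit.Theorems.SubseqIdentification.Negative.ProbabilityRedundant

/-!
# `TightIdentificationGlue`: eventual tightness + identification of subsequential limits ⟹ the SAW scaling limit

Route `SAWRenewalTightness` (sub-problem `SAWScalingLimit`), item `stmt-CriticalPhenomena-4538`
(`TightIdentificationGlue`, rendered as the route's `Assembly` frame):

  `EventualTight → SubseqIdentification → SAWScalingLimit`.

This is the soft common tail of every SAW route: Prokhorov's theorem on the Polish space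
`CurveClass ℂ` plus the subsequence principle along `𝓝[>] 0` and uniqueness of the chordal
SLE_{8/3} law (all PROVED in tree: `convergesInLawToSLE_of_isTightAlongMesh'`,
`SLEUniquenessInLaw.lean`). The only model-specific input is that the critical SAW laws
`SAW.law D.carrier δ (a δ) (b δ)` are probability measures for all small `δ` (they carry the junk
value `0` when `a δ, b δ` are not joined in `Ω_δ`), which is the tree's
`SubseqIdentification.Negative.eventually_isProbabilityMeasure_law`.

## Contents

* `convergesInLawToSLE_of_isTightAlongMesh_of_eventually` — the tree's convergence criterion
  `convergesInLawToSLE_of_isTightAlongMesh'` with the instance `[∀ δ, IsProbabilityMeasure (P δ)]`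
  weakened to `∀ᶠ δ in 𝓝[>] 0, IsProbabilityMeasure (P δ)` (generic in the configuration spaces):
  run the criterion on a surrogate family of probability laws on `CurveClass ℂ` that agrees with
  the push-forward laws `(P δ).map (Y δ)` for all small `δ`, and transfer along the germ at `0⁺`
  (`IsTightAlongMesh`, `IsSubseqLimitLaw`, `TendstoLaw` only see the germ).
* `saw_convergesInLawToSLE_of_isTightAlongMesh` — the SAW instance: under an endpoint
  approximation, tightness along the mesh + identification of the subsequential limit laws as
  SLE_κ laws give `ConvergesInLawToSLE κ D (fun δ γ ↦ γ.curve) (fun δ ↦ SAW.law …)`.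
* `saw_convergesInLawToSLE_of_isTightMeasureSet_image` — the same from set-level tightness of
  the push-forward laws on an initial mesh interval `(0, δ₀]` (the `EventualTight` form).
* `tightIdentificationGlue_proof` — the item: `EventualTight → SubseqIdentification →
  SAWScalingLimit` for the decls of `Theses/SAWRenewalTightness.lean` (`EventualTight` =
  stmt-CriticalPhenomena-1372, set-level tightness on `(0, δ₀]`).
* `tightIdentificationGlue_parafermion_proof` — the same item text as wanted by route
  `SAWParafermion`, whose `EventualTight` (stmt-CriticalPhenomena-1881) is the `IsTightAlongMesh`
  form; `SubseqIdentification` (stmt-CriticalPhenomena-0783) is shared verbatim.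

The item is not materialised as a `def` in either Theses file (stale `-- TODO … missing decl
EventualTight` line although `EventualTight` is now declared there), so both theorems are typed by
the item's TERM `EventualTight → SubseqIdentification → SAWScalingLimit` read in the respective
route namespace.

## References

* P. Billingsley, *Convergence of Probability Measures*, 2nd ed. (1999), Thm. 5.1 and its
  Corollary [BillingsleyCPM1999].
* H. Duminil-Copin, S. Smirnov, *Conformal invariance of lattice models* (2012), proof of
  Thm. 3.13 [DuminilCopinSmirnov2012].
-/

noncomputable section

open MeasureTheory Filter Topology Set
open scoped NNReal ENNReal BoundedContinuousFunction
open Literature.Probability.RandomPlanarGeometry Literature.Probability.LatticeModels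

namespace Summit.CriticalPhenomena.SAWScalingLimit.Theorems

/-! ### The convergence criterion with eventually-probability laws -/

/-- **Convergence to SLE_κ from tightness and identification, for laws that are probability
measures only eventually.** Let `Y δ : Ωδ δ → CurveClass ℂ` be random curve classes under laws
`P δ` which are probability measures and make `Y δ` a.e.-measurable for all small `δ > 0`. If the
family is tight as `δ → 0⁺` (`IsTightAlongMesh`) and every subsequential limit law that is a
probability measure is a chordal SLE_κ law in `(D; a, b)`, then `Y δ` converges in law to chordal
SLE_κ. Proof: the tree's criterion `convergesInLawToSLE_of_isTightAlongMesh'` (Prokhorov +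
subsequence principle + uniqueness of the SLE_κ law) applied to the surrogate family
`ν δ = (P δ).map (Y δ)` if that is a probability measure, `ν δ = δ_{c₀}` otherwise, observed
through the identity of `CurveClass ℂ`; `ν δ = (P δ).map (Y δ)` for all small `δ`, and tightness,
subsequential limits and convergence in law depend only on the germ of the family at `0⁺`.
[cite: BillingsleyCPM1999, Thm. 5.1, Corollary] -/
theorem convergesInLawToSLE_of_isTightAlongMesh_of_eventually {κ : ℝ≥0} {D : DobrushinDomain}
    {Ωδ : ℝ → Type*} [∀ δ, MeasurableSpace (Ωδ δ)] {Y : ∀ δ, Ωδ δ → CurveClass ℂ}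
    {P : ∀ δ, Measure (Ωδ δ)} (hP : ∀ᶠ δ in 𝓝[>] (0 : ℝ), IsProbabilityMeasure (P δ))
    (hY : ∀ᶠ δ in 𝓝[>] (0 : ℝ), AEMeasurable (Y δ) (P δ)) (hT : IsTightAlongMesh Y P)
    (hL : ∀ μ : Measure (CurveClass ℂ), IsProbabilityMeasure μ → IsSubseqLimitLaw Y P μ →
      IsSLELaw κ D μ) :
    ConvergesInLawToSLE κ D Y P := by
  classical
  -- (1) surrogate family of probability laws on the curve space
  obtain ⟨ν, hν⟩ : ∃ ν : ℝ → Measure (CurveClass ℂ), ∀ δ, ν δ =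
      if IsProbabilityMeasure ((P δ).map (Y δ)) then (P δ).map (Y δ)
      else Measure.dirac (CurveClass.mk (Curve.const 0)) :=
    ⟨_, fun _ => rfl⟩
  have hνprob : ∀ δ, IsProbabilityMeasure (ν δ) := by
    intro δ
    by_cases h : IsProbabilityMeasure ((P δ).map (Y δ))
    · rw [hν δ, if_pos h]
      exact h
    · rw [hν δ, if_neg h]
      infer_instance
  -- (2) for all small `δ` the surrogate IS the push-forward law
  have hev : ∀ᶠ δ in 𝓝[>] (0 : ℝ), AEMeasurable (Y δ) (P δ) ∧ ν δ = (P δ).map (Y δ) := by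
    filter_upwards [hP, hY] with δ hPδ hYδ
    haveI := hPδ
    refine ⟨hYδ, ?_⟩
    rw [hν δ, if_pos (Measure.isProbabilityMeasure_map hYδ)]
  -- (3) the criterion for the surrogate family, observed through the identity
  have key : ConvergesInLawToSLE κ D (Ωδ := fun _ : ℝ => CurveClass ℂ)
      (fun (_ : ℝ) (x : CurveClass ℂ) => x) ν := by
    haveI : ∀ δ, IsProbabilityMeasure (ν δ) := hνprob
    refine convergesInLawToSLE_of_isTightAlongMesh'
      (Filter.Eventually.of_forall fun δ => aemeasurable_id') ?_ ?_
    · -- tightness transfers along the germ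
      intro ε hε
      obtain ⟨K, hK, hb⟩ := hT ε hε
      refine ⟨K, hK, ?_⟩
      filter_upwards [hb, hev] with δ hδ hδ'
      have hpre : (fun x : CurveClass ℂ => x) ⁻¹' Kᶜ = Kᶜ := rfl
      rw [hpre, hδ'.2,
        Measure.map_apply_of_aemeasurable hδ'.1 hK.isClosed.isOpen_compl.measurableSet]
      exact hδ
    · -- subsequential limit laws of the surrogate are subsequential limit laws of `Y`
      rintro μ hμ ⟨s, hs, hlim⟩
      refine hL μ hμ ⟨s, hs, fun f => ?_⟩
      refine (hlim f).congr' ?_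
      filter_upwards [hs.eventually hev] with n hn
      beta_reduce
      rw [hn.2, integral_map hn.1 f.continuous.aestronglyMeasurable]
  -- (4) transfer the conclusion back along the germ
  obtain ⟨Γ, hΓ, -, hlaw⟩ := key
  refine ⟨Γ, hΓ, hY, fun f => ?_⟩
  refine (hlaw f).congr' ?_
  filter_upwards [hev] with δ hδ
  beta_reduce
  rw [hδ.2, integral_map hδ.1 f.continuous.aestronglyMeasurable]

/-! ### The SAW instances -/

/-- **SAW glue, tightness along the mesh.** For a Dobrushin domain `D` and an endpoint
approximation `(a δ, b δ)`: if the critical SAW curve laws are tight as `δ → 0⁺`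
(`IsTightAlongMesh`) and every subsequential weak limit law that is a probability measure is the
chordal SLE_κ law in `D`, then the SAW converges in law to chordal SLE_κ. The laws are probability
measures for all small `δ` (`eventually_isProbabilityMeasure_law`: `a δ, b δ` joined and `Ω_δ`
finite) and the curve observable is measurable (discrete σ-algebra), so
`convergesInLawToSLE_of_isTightAlongMesh_of_eventually` applies.
[cite: BillingsleyCPM1999, Thm. 5.1, Corollary] -/
theorem saw_convergesInLawToSLE_of_isTightAlongMesh {κ : ℝ≥0} {D : DobrushinDomain}
    {a b : ℝ → Site 2} (hab : SAW.IsEndpointApprox D a b)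
    (hT : IsTightAlongMesh (fun δ (γ : SAW.DomainSAW D.carrier δ (a δ) (b δ)) => γ.curve)
      (fun δ => SAW.law D.carrier δ (a δ) (b δ)))
    (hL : ∀ μ : Measure (CurveClass ℂ), IsProbabilityMeasure μ →
      IsSubseqLimitLaw (fun δ (γ : SAW.DomainSAW D.carrier δ (a δ) (b δ)) => γ.curve)
        (fun δ => SAW.law D.carrier δ (a δ) (b δ)) μ → IsSLELaw κ D μ) :
    ConvergesInLawToSLE κ D (fun δ (γ : SAW.DomainSAW D.carrier δ (a δ) (b δ)) => γ.curve)
      (fun δ => SAW.law D.carrier δ (a δ) (b δ)) :=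
  convergesInLawToSLE_of_isTightAlongMesh_of_eventually
    (SubseqIdentification.Negative.eventually_isProbabilityMeasure_law hab)
    (Filter.Eventually.of_forall fun δ => SAW.aemeasurable_curve D.carrier δ (a δ) (b δ)) hT hL

/-- **SAW glue, set-level tightness on an initial mesh interval** (the form `EventualTight` of the
SAW routes, output of the Aizenman–Burchard criterion): if for some `δ₀ > 0` the push-forward
laws `{(SAW.law …).map curve : δ ∈ (0, δ₀]}` form a tight set and every subsequential weak limit
law is the chordal SLE_κ law in `D`, then the SAW converges in law to chordal SLE_κ
(`isTightAlongMesh_of_isTightMeasureSet_image` + the previous theorem).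
[cite: BillingsleyCPM1999, Thm. 5.1, Corollary] -/
theorem saw_convergesInLawToSLE_of_isTightMeasureSet_image {κ : ℝ≥0} {D : DobrushinDomain}
    {a b : ℝ → Site 2} (hab : SAW.IsEndpointApprox D a b) {δ₀ : ℝ} (hδ₀ : 0 < δ₀)
    (hT : IsTightMeasureSet ((fun δ => (SAW.law D.carrier δ (a δ) (b δ)).map
      (fun γ => γ.curve)) '' Set.Ioc 0 δ₀))
    (hL : ∀ μ : Measure (CurveClass ℂ), IsProbabilityMeasure μ →
      IsSubseqLimitLaw (fun δ (γ : SAW.DomainSAW D.carrier δ (a δ) (b δ)) => γ.curve)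
        (fun δ => SAW.law D.carrier δ (a δ) (b δ)) μ → IsSLELaw κ D μ) :
    ConvergesInLawToSLE κ D (fun δ (γ : SAW.DomainSAW D.carrier δ (a δ) (b δ)) => γ.curve)
      (fun δ => SAW.law D.carrier δ (a δ) (b δ)) :=
  saw_convergesInLawToSLE_of_isTightAlongMesh hab
    (isTightAlongMesh_of_isTightMeasureSet_image
      (Filter.Eventually.of_forall fun δ => SAW.aemeasurable_curve D.carrier δ (a δ) (b δ))
      hδ₀ hT) hL

/-! ### The item -/

open Summit.CriticalPhenomena.SAWScalingLimit.Theses.SAWRenewalTightness in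
/-- **Item `stmt-CriticalPhenomena-4538` (`TightIdentificationGlue` / the `Assembly` frame of route
`SAWRenewalTightness`): `EventualTight → SubseqIdentification → SAWScalingLimit`.** Eventual
tightness of the pushed-forward critical SAW laws (T′) and identification of every subsequential
weak limit along `δ_n → 0⁺` as the chordal SLE_{8/3} law (I) imply the conjunct `SAWScalingLimit`:
for each `(D, a, b)` with `IsEndpointApprox`, apply
`saw_convergesInLawToSLE_of_isTightMeasureSet_image` with the `δ₀` of (T′) and the identification
(I) read through `IsSubseqLimitLaw`. [cite: BillingsleyCPM1999, Thm. 5.1, Corollary] -/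
theorem tightIdentificationGlue_proof :
    EventualTight → SubseqIdentification → _root_.SAWScalingLimit := by
  intro hT hI D a b hab
  obtain ⟨δ₀, hδ₀, htight⟩ := hT D a b hab
  refine saw_convergesInLawToSLE_of_isTightMeasureSet_image hab hδ₀ htight ?_
  rintro μ hμ ⟨s, hs, hlim⟩
  exact hI D a b hab s μ hs hμ hlim

open Summit.CriticalPhenomena.SAWScalingLimit.Theses.SAWParafermion in
/-- **Item `stmt-CriticalPhenomena-4538` as wanted by route `SAWParafermion`
(`TightIdentificationGlue`): `EventualTight → SubseqIdentification → SAWScalingLimit`** with that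
route's `EventualTight` = tightness along the mesh (`IsTightAlongMesh`, stmt-CriticalPhenomena-1881)
and the shared `SubseqIdentification` (stmt-CriticalPhenomena-0783): immediate from
`saw_convergesInLawToSLE_of_isTightAlongMesh`. [cite: BillingsleyCPM1999, Thm. 5.1, Corollary] -/
theorem tightIdentificationGlue_parafermion_proof :
    EventualTight → SubseqIdentification → _root_.SAWScalingLimit := by
  intro hT hI D a b hab
  refine saw_convergesInLawToSLE_of_isTightAlongMesh hab (hT D a b hab) ?_
  rintro μ hμ ⟨s, hs, hlim⟩
  exact hI D a b hab s μ hs hμ hlim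

end Summit.CriticalPhenomena.SAWScalingLimit.Theorems
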